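import Literature.AlgebraicGeometry.Pohlmann1968.DivisorClassesCMAlgebra
import Literature.FieldTheory.AlgClosed.AutomorphismExtension
import Literature.NumberTheory.ComplexMultiplication.CMTypeLattice
import Literature.Barriers.HodgeConjecture.ExceptionalHodgeClasses
import HarnessLib

/-!
# Barrier: the Hodge ring of a CM abelian variety need NOT be generated in codimension ≤ 2 (Hazama 2003, Remark 7.15 with (4.C); against Milne's transcription arXiv:0709.3040 Thm. 8.3)

Barrier catalogue `Literature/Barriers/HodgeConjecture` (D-0021). PROVED (no named fact, no `sorry`): the
whole file is a theorem about the tree's objects (`complexBetti`, `cupProduct`, `hodgeClassSpan`,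
`IsCMTypeRealisation`, Pohlmann's theorem `Pohlmann1968_thm1_cmAlgebra`).

## Sources read (held texts, verbatim)

* F. Hazama, *On the general Hodge conjecture for abelian varieties of CM-type*, Publ. RIMS 39 (2003)
  625–655 [Hazama2003GHCCM] (held `paper:url-aa47aaec4f82`, PDF pages = printed pages − 624):
  - (4.B)/(4.C) p. 631: "A finite right `G`-set `S`, plus the data of `S₁ ⊂ S` with `S` the disjoint sum of
    `S₁` and `S₁ρ`, give an abelian variety `A` of CM type (up to isogeny) … The first cohomology group
    `H¹(A, ℂ)` can be identified with `ℂ^S` … the complexification of the Hodge ring (`⊂ Λℂ^S`) admits as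
    basis the set of basis vectors of `Λℂ^S` corresponding to subsets `P` of `S` with the property that
    `#(P ∩ S₁g) = (#P)/2` for any `g ∈ G`. (4.1)"; for `A_{A(2ⁿ)}(G;K)` this is "(5.3) `#(P ∩ Hᵢ⁺) = (#P)/2`
    for `1 ≤ i ≤ n`" (p. 636), `S = R(A(2ⁿ)) = {±}ⁿ`.
  - (4.3) p. 634: "An abelian variety `A` of CM-type is said to be `N`-dominated if for every `n ≥ 1` the
    Hodge ring `H(Aⁿ)_ℂ` of `Aⁿ` is spanned by the Hodge classes `[P]`, `P ⊂ S(n)` with `#(P) ≤ 2N`.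
    Remark. In [3, Definition 4.5], the notion of `N`-dominatedness is defined only for simple abelian
    varieties …" ([3] = Hazama, J. Alg. Geom. 9 (2000) 711–753, NOT held; its Def. 4.5 / Prop. 4.9 were
    not read — see `scope_caveats`).
  - Thm. 7.13 p. 650: "The kernel of the Hodge matrix `H(A(2ⁿ))` is spanned by `σd_a` … and `σz_{ij}` …"
    (a `ℚ`-span, Lemma 7.12: "`⟨σz_{ij}; σ ∈ Bₙ⟩_ℚ`"); Thm. 7.14 p. 650: "When `n ≥ 3`, the abelian variety
    `A_{A(2ⁿ)}(G;K)` is `1`-degenerate and `2`-dominated."; Cor. 7.14.1; Prop. 6.5 p. 644: "Any abelian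
    variety split by `K` is realized up to isogeny as an abelian subvariety of a certain self-product
    `A_{A(2ⁿ)}(G;K)ᵐ`"; Thm. 8.2 p. 651, Corollary p. 654, Thm. 8.3 p. 655 (HC in codimension two on the
    `A_{A(2ⁿ)}(G;K)` ⟹ GHC for all CM abelian varieties).
  - **Remark 7.15 p. 650**: "The `N`-dominatedness does not imply that every element in the kernel of the
    Hodge matrix is expressed as a linear combination of integral vectors of height `N` with nonnegative
    coefficients. When `n = 4`, for example, the element
    `v = (0,0,0,0) + (0,0,1,1) + (0,1,0,1) + (1,0,0,1) + 2(1,1,1,0) ∈ V(A(2⁴))` belongs to the kernel of the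
    Hodge matrix `H(A(2⁴))`, and one can check that `v` cannot be expressed as a linear combination of the
    elements in Theorem 7.12 with nonnegative coefficients. But it is expressed simply as
    `v = z₂₄ + z₃₄ − z₂₃ + d₀₁₁₀`, and hence the theory developed in [3] assures that the algebraicity of the
    Hodge cycle corresponding to `v` on `A_{A(2⁴)}(G;K)²` is implied by that of the Hodge cycles corresponding
    to `z₂₄, z₃₄, z₂₃`."
* J. S. Milne, *The Tate conjecture over finite fields (AIM talk)*, arXiv:0709.3040 [Milne2007TateFiniteFieldsAIM]
  (held `paper:arxiv-0709.3040`), §8.2: "Let `ρ` be a faithful linear representation of `G` on `ℝᵐ` such that `G`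
  acts transitively on the set `a(2ᵐ)` of coordinate hyperplanes and `ρ(ι)` acts as `−1` on `ℝᵐ`. The pair
  `(R(2ᵐ), R(2ᵐ)⁺)` then … defines a CM abelian variety `A = A(G,K,ρ)` of dimension `2^{m−1}` split by `K`. The
  next statement is the main technical result of [hazama2003]. **Theorem 8.3.** Let `A = A(G,K,ρ)`. For every
  `n ≥ 0`, the `ℚ`-algebra `B*(Aⁿ)` is generated by the classes of degree `≤ 2`. Proof. See [hazama2003], 7.";
  Prop. 8.4: "Every simple CM abelian variety split by `K` is isogenous to a subvariety of `A(G,K,ρ_Φ)`";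
  Thm. 8.5: "In order to prove the Hodge conjecture for CM abelian varieties over `ℂ`, it suffices to prove it
  in codimension `2`. Proof. If the Hodge conjecture holds in codimension `2`, then Theorem 8.3 shows that it
  holds for the varieties `A(G,K,ρ_Φ)ⁿ` …".

## The barrier

In the exterior-algebra description (4.C)/(5.3) a cup product of basis monomials is `[P] ⌣ [Q] = ± [P ⊔ Q]`
(or `0`), and the codimension-`≤ 2` Hodge classes of any power are spanned by the `[Q]` with `Q` balanced of size
`2` or `4`; a balanced PAIR is a complementary pair `{ε, −ε}`. The six sign vectors of Hazama's `v` (each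
coordinate carries three `0`'s and three `1`'s, so `v` is balanced of height `3`) contain no complementary pair.
Hence the monomial `[P_v] ∈ B³ ⊗ ℂ` has coefficient `0` along every element of the two-sided ideal generated by
`B¹ ⊗ ℂ`, in particular along `B¹B¹B¹ + B¹B² + B²B¹`: **the Hodge ring is not generated by its classes of
codimension `≤ 2`**, although it is `2`-dominated in Hazama's sense (Thm. 7.14: `ℚ`-combinations
`z₂₄ + z₃₄ − z₂₃ + d₀₁₁₀`, transported by the correspondences of [3] / Prop. 4.2–4.3). Read literally ("the
`ℚ`-algebra `B*(Aⁿ)` is generated by the classes of degree `≤ 2`"), Milne's transcription Thm. 8.3 of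
Thm. 7.14 therefore fails for `m = 4`; Thm. 8.5 (= Hazama's Thm. 8.3, HC for CM abelian varieties ⇐ HC in
codimension `2`) is Hazama's theorem and is NOT affected — only the one-line mechanism "products of algebraic
classes" is.

## Lean rendering (real definitions of the tree only)

The tree has no model of `A_{A(2ⁿ)}(G;K)`; it has Pohlmann's theorem for PRODUCTS of realisations of CM types
(`Pohlmann1968/HodgeClassesCMAlgebra`, `DivisorClassesCMAlgebra`: `Bᵖ(⨁ Aᵢ) ⊗ ℂ = ⊕_{S balanced} H^{2p}_S`, the
cup-monomial basis `exists_monomialBasis`, `cupProduct_cupPowOne_cupPowOne`). Hazama's multiset of six CM types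
on a CM field `K` of degree `8` is, for the CM type `Φ = (1,1,1,0)` of his frame, the family
`u_φ (φ ∈ Φ), Φ, Φ` with `u_φ = {φ} ∪ conj(Φ ∖ {φ})` (`coflipType`, `hazamaFamily`; in the frame:
`(1,0,0,1), (0,1,0,1), (0,0,1,1), (0,0,0,0), (1,1,1,0), (1,1,1,0)`), and the class "corresponding to `v`" is
rendered on the product `B = ⨁_{i<6} Aᵢ` of realisations `(Aᵢ, ιᵢ, θᵢ)` of these six types
(`IsCMTypeRealisation`, Shimura §5.2) as the cup monomial of `P₀ = {(i, φ₀) | i < 6}` (`hazamaSet`; `φ₀ ∈ Φ`;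
balancedness `isGaloisBalancedAlg_hazamaSet` = "every embedding of `K` lies in exactly three of the six types",
no balanced sub-pair `not_isGaloisBalancedAlg_pair`). Statements:

* `exists_hodgeClass_not_mem_divisorIdealSix` — a rational `(3,3)`-class of `B` outside
  `divisorIdealSix = (B¹ ⊗ ℂ) ⌣ H⁴ + H⁴ ⌣ (B¹ ⊗ ℂ)`;
* `exists_hodgeClass_not_mem_codimTwoGeneratedSix` — … outside `codimTwoGeneratedSix = B¹B¹B¹ + B¹B² + B²B¹`
  (complexified, all bracketings): **`B*(B)` is not generated in codimension `≤ 2`**;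
* `exists_hodgeClass_not_mem_divisorClassesSpan_three` — … outside `D³ ⊗ ℂ` (`divisorClassesSpan`, the
  catalogue's `ExceptionalHodgeClasses` vocabulary): an exceptional class of codimension `3`;
* `exists_cmProduct_hodgeRing_not_generated_in_codim_two` — closed form for every CM field `K` with
  `[K:ℚ] = 8` and every CM type `Φ`, under the tree's existence record `PicardCM.CMAbelianVarietyRealised`
  (Shimura §6.2 Thm. 3; a hypothesis here, discharged Summits-side).

The engine (`repr_cupPowOne_comp_eq_zero`, `repr_cupProduct_monomial_eq_zero`, `coord_cupProduct_eq_zero_left/right`: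
support of products of monomials; `weightChar_eq_of_repr_ne_zero`, `eq_pair_of_weightChar_eq`: a weight class with
a non-zero coordinate on a transversal pair has the weight of that pair, tested on `a = (1,…,2,…,1)` and
`(1,…,α,…,1) ∈ 𝓞_K⁶`) is proved for any product of CM-type realisations.

## References

* [Hazama2003GHCCM] F. Hazama, Publ. RIMS 39 (2003) 625–655: (4.B)/(4.C)/(4.1) p. 631, p. 632, (4.3) p. 634,
  (5.3) p. 636, Prop. 6.5 p. 644, Lemma 7.12, Thm. 7.13, Thm. 7.14, Cor. 7.14.1, Remark 7.15 p. 650, Thm. 8.2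
  p. 651, Thm. 8.3 p. 655; its [3] = F. Hazama, Hodge cycles on abelian varieties of `Sₙ`-type, J. Alg. Geom. 9
  (2000) 711–753, Def. 4.5, Prop. 4.9 (not held).
* [Milne2007TateFiniteFieldsAIM] J. S. Milne, arXiv:0709.3040, §8.2: Thm. 8.3, Prop. 8.4, Thm. 8.5 (and Lemma 2.1
  of Hazama for the passage to abelian subvarieties / isogeny factors).
* [Pohlmann1968] H. Pohlmann, Ann. of Math. 88 (1968) 161–180, Thm. 1.
* [vanGeemen1994HodgeAV] B. van Geemen, LNM 1594, §2.4–2.5 (`Dᵖ`, exceptional classes).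
* [Shimura1998] G. Shimura, Abelian varieties with complex multiplication and modular functions, §5.2, §6.2 Thm. 3.
* [Milne2020HodgeClassesAV] J. S. Milne, Hodge classes on abelian varieties (2020), 1.2 (a)–(c) (eigen-decomposition).
* [GaoUllmo2025] Z. Gao, E. Ullmo, J. Inst. Math. Jussieu 25 (2025), Thm. 3.1 (3.2) (balancedness for CM algebras).
* [HatcherAT2002] A. Hatcher, Algebraic Topology, §3.2 (cup product).
-/

noncomputable section

open CategoryTheory CategoryTheory.Limits

namespace Literature.Barriers.HodgeConjecture

open Literature.AlgebraicTopology.SingularHomology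
open Literature.AlgebraicGeometry.Motives (AbelianVariety CMType IsSmoothProjective ComplexPoints)
open Literature.AlgebraicGeometry.HodgeTheory
open Literature.AlgebraicGeometry.Pohlmann1968
open Literature.AlgebraicGeometry.ComplexMultiplication (IsCMTypeRealisation)
open Literature.AlgebraicGeometry.VanGeemen1994 (hodgeClassSpan)
open NumberField NumberField.ComplexEmbedding

section Engine

variable {B : AbelianVariety ℂ} {I : Type} [LinearOrder I]
  (w : Module.Basis I ℂ (complexBetti B.X 1))

/-- Products of iterated cup products in a prescribed degree: `(v₁ ⌣ ⋯ ⌣ v_d) ⌣ (v'₁ ⌣ ⋯ ⌣ v'_e)` is the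
iterated product of the concatenated family. [cite: HatcherAT2002, §3.2] -/
theorem cupProduct_cupPowOne_cupPowOne_of_eq {d e m : ℕ} (h : d + e = m)
    (v : Fin d → complexBetti B.X 1) (v' : Fin e → complexBetti B.X 1) :
    cupProduct h (cupPowOne ℂ (ComplexPoints B.X) d v) (cupPowOne ℂ (ComplexPoints B.X) e v') =
      cupPowOne ℂ (ComplexPoints B.X) m (Fin.append v v' ∘ Fin.cast h.symm) := by
  subst h
  exact cupProduct_cupPowOne_cupPowOne ℂ v v'

variable {d : ℕ} {b : Module.Basis (Set.powersetCard I d) ℂ (complexBetti B.X d)}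

/-- Support of a reindexed monomial: `w_{f 0} ⌣ ⋯ ⌣ w_{f (d-1)}` is `± [im f]` (`f` injective, alternating
reordering) or `0` (`f` not injective), so its coordinate on every other `d`-set vanishes. [cite: Hazama2003GHCCM, (4.C)/(4.1) p. 631] [cite: HatcherAT2002, §3.2] -/
theorem repr_cupPowOne_comp_eq_zero
    (hb : ∀ s, b s = cupPowOne ℂ (ComplexPoints B.X) d
      (fun j => w (Set.powersetCard.ofFinEmbEquiv.symm s j)))
    (f : Fin d → I) {s : Set.powersetCard I d} (hs : (s : Finset I) ≠ Finset.univ.image f) :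
    b.repr (cupPowOne ℂ (ComplexPoints B.X) d (w ∘ f)) s = 0 := by
  classical
  by_cases hf : Function.Injective f
  · -- `f` enumerates the `d`-set `t = im f`, up to a permutation of `Fin d`
    let t : Set.powersetCard I d := ⟨Finset.univ.image f, by
      rw [Set.powersetCard.mem_iff, Finset.card_image_of_injective _ hf, Finset.card_univ,
        Fintype.card_fin]⟩
    have hst : s ≠ t := fun h => hs (by rw [h])
    let g : Fin d ↪o I := Set.powersetCard.ofFinEmbEquiv.symm t
    have hmem : ∀ k, f k ∈ Set.range g := fun k => by
      rw [Set.powersetCard.mem_range_ofFinEmbEquiv_symm_iff_mem, ← Set.powersetCard.mem_coe_iff]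
      exact Finset.mem_image_of_mem f (Finset.mem_univ k)
    choose σ hσ using hmem
    have hσinj : Function.Injective σ := fun k k' hk => hf (by rw [← hσ k, ← hσ k', hk])
    let τ : Equiv.Perm (Fin d) := Equiv.ofBijective σ hσinj.bijective_of_finite
    have hwf : w ∘ f = (w ∘ g) ∘ τ := by
      funext k
      simp only [Function.comp_apply, τ, Equiv.ofBijective_apply, hσ]
    have hperm : cupPowOne ℂ (ComplexPoints B.X) d ((w ∘ g) ∘ τ) =
        ((Equiv.Perm.sign τ : ℤ) : ℂ) • cupPowOne ℂ (ComplexPoints B.X) d (w ∘ g) := by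
      rw [← cupPowOneAlt_apply, AlternatingMap.map_perm, cupPowOneAlt_apply, Units.smul_def,
        Int.cast_smul_eq_zsmul]
    have hg : cupPowOne ℂ (ComplexPoints B.X) d (w ∘ g) = b t := (hb t).symm
    rw [hwf, hperm, hg, map_smul, Finsupp.smul_apply, b.repr_self, Finsupp.single_eq_of_ne hst,
      smul_zero]
  · have h0 : cupPowOne ℂ (ComplexPoints B.X) d (w ∘ f) = 0 := by
      rw [← cupPowOneAlt_apply]
      exact AlternatingMap.map_eq_zero_of_not_injective _ _ fun h => hf (Function.Injective.of_comp h)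
    rw [h0, map_zero, Finsupp.zero_apply]


/-- The image of a concatenated enumeration is the union of the images. [folklore] -/
private theorem image_append_comp_cast {d e m : ℕ} (h : d + e = m) (g : Fin d → I) (g' : Fin e → I) :
    Finset.univ.image (Fin.append g g' ∘ Fin.cast h.symm) =
      Finset.univ.image g ∪ Finset.univ.image g' := by
  classical
  subst h
  ext x
  simp only [Finset.mem_image, Finset.mem_univ, true_and, Finset.mem_union, Function.comp_apply]
  constructor
  · rintro ⟨k, rfl⟩
    refine Fin.addCases (fun i => ?_) (fun j => ?_) k
    · exact Or.inl ⟨i, by simp⟩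
    · exact Or.inr ⟨j, by simp⟩
  · rintro (⟨i, rfl⟩ | ⟨j, rfl⟩)
    · exact ⟨Fin.castAdd e i, by simp⟩
    · exact ⟨Fin.natAdd d j, by simp⟩

variable {e m : ℕ} {b' : Module.Basis (Set.powersetCard I e) ℂ (complexBetti B.X e)}
  {b'' : Module.Basis (Set.powersetCard I m) ℂ (complexBetti B.X m)}

/-- Support of a product of two monomials: `[T] ⌣ [U]` has zero coordinate off `T ∪ U` (`[T] ⌣ [U] = ± [T ⊔ U]`
or `0`, the exterior-algebra rule of (4.C)). [cite: Hazama2003GHCCM, (4.C)/(4.1) p. 631] [cite: HatcherAT2002, §3.2] -/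
theorem repr_cupProduct_monomial_eq_zero (h : d + e = m)
    (hb : ∀ s, b s = cupPowOne ℂ (ComplexPoints B.X) d
      (fun j => w (Set.powersetCard.ofFinEmbEquiv.symm s j)))
    (hb' : ∀ s, b' s = cupPowOne ℂ (ComplexPoints B.X) e
      (fun j => w (Set.powersetCard.ofFinEmbEquiv.symm s j)))
    (hb'' : ∀ s, b'' s = cupPowOne ℂ (ComplexPoints B.X) m
      (fun j => w (Set.powersetCard.ofFinEmbEquiv.symm s j)))
    (T : Set.powersetCard I d) (U : Set.powersetCard I e) {S : Set.powersetCard I m}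
    (hS : (S : Finset I) ≠ (T : Finset I) ∪ (U : Finset I)) :
    b''.repr (cupProduct h (b T) (b' U)) S = 0 := by
  classical
  rw [hb T, hb' U, cupProduct_cupPowOne_cupPowOne_of_eq h]
  have hcomp : (Fin.append (fun j => w (Set.powersetCard.ofFinEmbEquiv.symm T j))
      (fun j => w (Set.powersetCard.ofFinEmbEquiv.symm U j))) ∘ Fin.cast h.symm =
      w ∘ (Fin.append (Set.powersetCard.ofFinEmbEquiv.symm T) (Set.powersetCard.ofFinEmbEquiv.symm U) ∘
        Fin.cast h.symm) := by
    funext k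
    simp only [Function.comp_apply]
    refine Fin.addCases (fun i => ?_) (fun j => ?_) (Fin.cast h.symm k) <;> simp
  rw [hcomp]
  refine repr_cupPowOne_comp_eq_zero w hb'' _ ?_
  rw [image_append_comp_cast h]
  have hT : Finset.univ.image (Set.powersetCard.ofFinEmbEquiv.symm T : Fin d → I) = (T : Finset I) := by
    ext x
    rw [Finset.mem_image]
    simp only [Finset.mem_univ, true_and]
    rw [← Set.mem_range, Set.powersetCard.mem_range_ofFinEmbEquiv_symm_iff_mem, Set.powersetCard.mem_coe_iff]
  have hU : Finset.univ.image (Set.powersetCard.ofFinEmbEquiv.symm U : Fin e → I) = (U : Finset I) := by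
    ext x
    rw [Finset.mem_image]
    simp only [Finset.mem_univ, true_and]
    rw [← Set.mem_range, Set.powersetCard.mem_range_ofFinEmbEquiv_symm_iff_mem, Set.powersetCard.mem_coe_iff]
  rw [hT, hU]
  exact hS

/-- Pulling a finite combination out of the left factor of a cup product (bilinearity). [cite: HatcherAT2002, §3.2] -/
theorem cupProduct_sum_smul_left {p q n : ℕ} (h : p + q = n) {α : Type} (s : Finset α) (c : α → ℂ)
    (v : α → complexBetti B.X p) (z : complexBetti B.X q) :
    cupProduct h (∑ a ∈ s, c a • v a) z = ∑ a ∈ s, c a • cupProduct h (v a) z := by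
  rw [map_sum, LinearMap.sum_apply]
  exact Finset.sum_congr rfl fun a _ => by rw [map_smul, LinearMap.smul_apply]

/-- Pulling a finite combination out of the right factor of a cup product (bilinearity). [cite: HatcherAT2002, §3.2] -/
theorem cupProduct_sum_smul_right {p q n : ℕ} (h : p + q = n) (x : complexBetti B.X p) {α : Type}
    (s : Finset α) (c : α → ℂ) (v : α → complexBetti B.X q) :
    cupProduct h x (∑ a ∈ s, c a • v a) = ∑ a ∈ s, c a • cupProduct h x (v a) := by
  rw [map_sum]
  exact Finset.sum_congr rfl fun a _ => by rw [map_smul]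

variable [Fintype I]

/-- The `P`-coordinate of `x ⌣ z` vanishes when `x` has no coordinate on the `d`-subsets of `P`: expand both
factors in the monomial bases; `[T] ⌣ [U]` contributes to `[P]` only if `T ∪ U = P`, forcing `T ⊆ P`. [cite: Hazama2003GHCCM, (4.C)/(4.1) p. 631] -/
theorem coord_cupProduct_eq_zero_left (h : d + e = m)
    (hb : ∀ s, b s = cupPowOne ℂ (ComplexPoints B.X) d
      (fun j => w (Set.powersetCard.ofFinEmbEquiv.symm s j)))
    (hb' : ∀ s, b' s = cupPowOne ℂ (ComplexPoints B.X) e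
      (fun j => w (Set.powersetCard.ofFinEmbEquiv.symm s j)))
    (hb'' : ∀ s, b'' s = cupPowOne ℂ (ComplexPoints B.X) m
      (fun j => w (Set.powersetCard.ofFinEmbEquiv.symm s j)))
    (P : Set.powersetCard I m) {x : complexBetti B.X d}
    (hx : ∀ T : Set.powersetCard I d, (T : Finset I) ⊆ (P : Finset I) → b.repr x T = 0)
    (z : complexBetti B.X e) :
    b''.coord P (cupProduct h x z) = 0 := by
  classical
  rw [← b.sum_repr x, cupProduct_sum_smul_left, map_sum]
  refine Finset.sum_eq_zero fun T _ => ?_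
  rw [map_smul, smul_eq_mul]
  by_cases hT : (T : Finset I) ⊆ (P : Finset I)
  · rw [hx T hT, zero_mul]
  · rw [← b'.sum_repr z, cupProduct_sum_smul_right, map_sum]
    refine mul_eq_zero_of_right _ (Finset.sum_eq_zero fun U _ => ?_)
    rw [map_smul, smul_eq_mul, Module.Basis.coord_apply,
      repr_cupProduct_monomial_eq_zero w h hb hb' hb'' T U
        (fun hP => hT (hP ▸ Finset.subset_union_left)), mul_zero]

/-- The `P`-coordinate of `z ⌣ x` vanishes when `x` has no coordinate on the `e`-subsets of `P` (mirror image of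
`coord_cupProduct_eq_zero_left`). [cite: Hazama2003GHCCM, (4.C)/(4.1) p. 631] -/
theorem coord_cupProduct_eq_zero_right (h : d + e = m)
    (hb : ∀ s, b s = cupPowOne ℂ (ComplexPoints B.X) d
      (fun j => w (Set.powersetCard.ofFinEmbEquiv.symm s j)))
    (hb' : ∀ s, b' s = cupPowOne ℂ (ComplexPoints B.X) e
      (fun j => w (Set.powersetCard.ofFinEmbEquiv.symm s j)))
    (hb'' : ∀ s, b'' s = cupPowOne ℂ (ComplexPoints B.X) m
      (fun j => w (Set.powersetCard.ofFinEmbEquiv.symm s j)))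
    (P : Set.powersetCard I m) (z : complexBetti B.X d) {x : complexBetti B.X e}
    (hx : ∀ U : Set.powersetCard I e, (U : Finset I) ⊆ (P : Finset I) → b'.repr x U = 0) :
    b''.coord P (cupProduct h z x) = 0 := by
  classical
  rw [← b'.sum_repr x, cupProduct_sum_smul_right, map_sum]
  refine Finset.sum_eq_zero fun U _ => ?_
  rw [map_smul, smul_eq_mul]
  by_cases hU : (U : Finset I) ⊆ (P : Finset I)
  · rw [hx U hU, zero_mul]
  · rw [← b.sum_repr z, cupProduct_sum_smul_left, map_sum]
    refine mul_eq_zero_of_right _ (Finset.sum_eq_zero fun T _ => ?_)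
    rw [map_smul, smul_eq_mul, Module.Basis.coord_apply,
      repr_cupProduct_monomial_eq_zero w h hb hb' hb'' T U
        (fun hP => hU (hP ▸ Finset.subset_union_right)), mul_zero]

end Engine

/-! ### The six CM types of Hazama's Remark 7.15 -/

section HazamaTypes

variable {K : Type} [Field K]

/-- For a CM type `Φ` and `φ ∈ Φ`, the CM type `u_φ = {φ} ⊔ conj(Φ ∖ {φ})` — in Hazama's sign coordinates relative
to the frame `Φ`, the vector with exactly one `0`, at `φ` (the set-builder formula defines a CM type for every
`φ`; only `φ ∈ Φ` is used). [cite: Hazama2003GHCCM, Remark 7.15 p. 650] -/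
def coflipType (Φ : CMType K) (φ : K →+* ℂ) : CMType K :=
  ⟨{s | (s ∈ Φ.1 ∧ s = φ) ∨ (s ∉ Φ.1 ∧ conjugate s ≠ φ)}, fun s => by
    have hinv : conjugate (conjugate s) = s := involutive_conjugate K s
    by_cases hs : s ∈ Φ.1
    · have hcs : conjugate s ∉ Φ.1 := (Φ.2 s).1 hs
      simp only [Set.mem_setOf_eq, hinv]
      tauto
    · have hcs : conjugate s ∈ Φ.1 := by
        have h' := (Φ.2 (conjugate s)).2
        rw [hinv] at h'
        exact h' hs
      simp only [Set.mem_setOf_eq, hinv]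
      tauto⟩

/-- Unfolding of `coflipType`. [cite: Hazama2003GHCCM, Remark 7.15 p. 650] -/
theorem mem_coflipType_iff (Φ : CMType K) (φ s : K →+* ℂ) :
    s ∈ (coflipType Φ φ).1 ↔ (s ∈ Φ.1 ∧ s = φ) ∨ (s ∉ Φ.1 ∧ conjugate s ≠ φ) := Iff.rfl

/-- The conjugate of a non-member of a CM type is a member (`Φ ⊔ conj Φ = Hom(K, ℂ)`). [folklore] -/
private theorem conjugate_mem_of_not_mem (Φ : CMType K) {s : K →+* ℂ} (hs : s ∉ Φ.1) : conjugate s ∈ Φ.1 := by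
  have h' := (Φ.2 (conjugate s)).2
  rw [involutive_conjugate K s] at h'
  exact h' hs

/-- The family of six CM types `(u_{e 0}, u_{e 1}, u_{e 2}, u_{e 3}, Φ, Φ)` for an enumeration `e` of `Φ` — Hazama's
multiset `v = (0000) + (0011) + (0101) + (1001) + 2(1110)` written for the frame in which `Φ = (1110)`. [cite: Hazama2003GHCCM, Remark 7.15 p. 650] -/
def hazamaFamily (Φ : CMType K) (e : Fin 4 → (K →+* ℂ)) (i : Fin 6) : CMType K :=
  if h : i.val < 4 then coflipType Φ (e ⟨i.val, h⟩) else Φ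

variable {Φ : CMType K} {e : Fin 4 → (K →+* ℂ)}

/-- Membership of a member `e k` of `Φ` in the six types: in `u_{e i}` iff `k = i`, always in `Φ`. [cite: Hazama2003GHCCM, Remark 7.15 p. 650] -/
theorem mem_hazamaFamily_iff_of_eq (he : Function.Injective e)
    (hΦe : ∀ t, t ∈ Φ.1 ↔ t ∈ Set.range e) (k : Fin 4) (i : Fin 6) :
    e k ∈ (hazamaFamily Φ e i).1 ↔ (i.val < 4 → k.val = i.val) := by
  have hk : e k ∈ Φ.1 := (hΦe _).2 ⟨k, rfl⟩
  unfold hazamaFamily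
  split_ifs with h
  · rw [mem_coflipType_iff]
    constructor
    · rintro (⟨-, h1⟩ | ⟨h1, -⟩)
      · exact fun _ => by rw [he h1]
      · exact absurd hk h1
    · intro h1
      exact Or.inl ⟨hk, congrArg e (Fin.ext (h1 h))⟩
  · simp only [hk, true_iff]
    exact fun h' => absurd h' h

/-- Membership of the conjugate of a member `e k` of `Φ` in the six types: in `u_{e i}` iff `k ≠ i`, never in `Φ`.
[cite: Hazama2003GHCCM, Remark 7.15 p. 650] -/
theorem conjugate_mem_hazamaFamily_iff (he : Function.Injective e)
    (hΦe : ∀ t, t ∈ Φ.1 ↔ t ∈ Set.range e) (k : Fin 4) (i : Fin 6) :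
    conjugate (e k) ∈ (hazamaFamily Φ e i).1 ↔ (i.val < 4 ∧ k.val ≠ i.val) := by
  have hk : e k ∈ Φ.1 := (hΦe _).2 ⟨k, rfl⟩
  have hck : conjugate (e k) ∉ Φ.1 := (Φ.2 _).1 hk
  have hinv : conjugate (conjugate (e k)) = e k := involutive_conjugate K (e k)
  unfold hazamaFamily
  split_ifs with h
  · rw [mem_coflipType_iff, hinv]
    constructor
    · rintro (⟨h1, -⟩ | ⟨-, h1⟩)
      · exact absurd h1 hck
      · exact ⟨h, fun h2 => h1 (congrArg e (Fin.ext h2))⟩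
    · rintro ⟨-, h1⟩
      exact Or.inr ⟨hck, fun h2 => h1 (by rw [he h2])⟩
  · simp only [hck, h, false_and]

/-- Counting on `Fin 6`: a member of `Φ` lies in exactly three of the six types (its own `u`, `Φ`, `Φ`). [cite: Hazama2003GHCCM, Remark 7.15 p. 650] -/
theorem card_filter_mem_hazamaFamily (k : Fin 4) :
    (Finset.univ.filter fun i : Fin 6 => (i.val < 4 → k.val = i.val)).card = 3 ∧
    (Finset.univ.filter fun i : Fin 6 => ¬ (i.val < 4 → k.val = i.val)).card = 3 := by
  revert k; decide

/-- Counting on `Fin 6`: the conjugate of a member of `Φ` lies in exactly three of the six types (the three other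
`u`'s). [cite: Hazama2003GHCCM, Remark 7.15 p. 650] -/
theorem card_filter_conjugate_mem_hazamaFamily (k : Fin 4) :
    (Finset.univ.filter fun i : Fin 6 => (i.val < 4 ∧ k.val ≠ i.val)).card = 3 ∧
    (Finset.univ.filter fun i : Fin 6 => ¬ (i.val < 4 ∧ k.val ≠ i.val)).card = 3 := by
  revert k; decide

/-- Counting on `Fin 6`: for two different slots there is a member of `Φ` lying in both types or in neither — the
witness that no sub-pair of `v` is balanced (no two of the six sign vectors are complementary). [cite: Hazama2003GHCCM, Remark 7.15 p. 650] -/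
theorem hazamaFamily_exists_witness (i j : Fin 6) (hij : i ≠ j) :
    ∃ k : Fin 4, ((i.val < 4 → k.val = i.val) ↔ (j.val < 4 → k.val = j.val)) := by
  revert i j; decide

end HazamaTypes

section Weights

variable {n : ℕ} {K : Fin n → Type} [∀ i, Field (K i)] [∀ i, NumberField (K i)]
  {A : Fin n → AbelianVariety ℂ} {ι : ∀ i, 𝓞 (K i) →+* End (A i)}

/-- The weight character `χ_S(a) = ∏_{(i,s) ∈ S} s(a_i)` (`a ∈ ∏_i 𝓞_{K_i}`) of a finite set of indexed embeddings —
the eigenvalue of `(⊕_i ι_i(a_i))^*` on the weight space `weightClassesAlg _ _ _ S`. [cite: Milne2020HodgeClassesAV, 1.2 (a)] -/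
def weightChar (S : Finset ((_i : Fin n) × (K _i →+* ℂ))) (a : ∀ i, 𝓞 (K i)) : ℂ :=
  ∏ x ∈ S, x.2 ((a x.1 : 𝓞 (K x.1)) : K x.1)

variable {I : Type} [LinearOrder I]

/-- A weight class of weight `S` with a non-zero coordinate on the monomial `[T]` has `χ_T = χ_S` on all of
`∏_i 𝓞_{K_i}` (compare the `T`-coordinates of `(⊕ ι_i(a_i))^* c` computed on `c` and on the eigen-monomials).
[cite: Milne2020HodgeClassesAV, 1.2 (a)] -/
theorem weightChar_eq_of_repr_ne_zero [LinearOrder ((_i : Fin n) × (K _i →+* ℂ))]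
    {w : Module.Basis ((_i : Fin n) × (K _i →+* ℂ)) ℂ (complexBetti (⨁ A).X 1)}
    (hw : ∀ (c : ∀ i, 𝓞 (K i)) (x : (_i : Fin n) × (K _i →+* ℂ)),
      complexBetti.map (biproduct.map fun i => ι i (c i)).hom.hom.hom 1 (w x) =
        x.2 ((c x.1 : 𝓞 (K x.1)) : K x.1) • w x)
    {d : ℕ} {b : Module.Basis (Set.powersetCard ((_i : Fin n) × (K _i →+* ℂ)) d) ℂ (complexBetti (⨁ A).X d)}
    (hb : ∀ s, b s = cupPowOne ℂ (ComplexPoints (⨁ A).X) d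
      (fun j => w (Set.powersetCard.ofFinEmbEquiv.symm s j)))
    {S : Finset ((_i : Fin n) × (K _i →+* ℂ))} {c : complexBetti (⨁ A).X d}
    (hc : c ∈ weightClassesAlg A ι d S) {T : Set.powersetCard ((_i : Fin n) × (K _i →+* ℂ)) d}
    (hT : b.repr c T ≠ 0) (a : ∀ i, 𝓞 (K i)) :
    weightChar (T : Finset _) a = weightChar S a := by
  classical
  set f := (biproduct.map fun i => ι i (a i)).hom.hom.hom with hf
  -- `f^*` acts on the monomial `b T'` by `χ_{T'}(a)`
  have hmono : ∀ T' : Set.powersetCard ((_i : Fin n) × (K _i →+* ℂ)) d,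
      complexBetti.map f d (b T') = weightChar (T' : Finset _) a • b T' := fun T' =>
    map_monomial_eq_prod_smul hb f (μ := fun x => x.2 ((a x.1 : 𝓞 (K x.1)) : K x.1)) (hw a) T'
  -- the `T`-coefficient of `f^* c` computed in two ways
  have h1 : b.repr (complexBetti.map f d c) T = weightChar (T : Finset _) a * b.repr c T := by
    conv_lhs => rw [← b.sum_repr c]
    rw [map_sum, map_sum, Finsupp.coe_finsetSum, Finset.sum_apply]
    rw [Finset.sum_eq_single T]
    · rw [map_smul, hmono, map_smul, map_smul, b.repr_self, Finsupp.smul_apply, Finsupp.smul_apply,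
        Finsupp.single_eq_same, smul_eq_mul, smul_eq_mul, mul_one, mul_comm]
    · intro T' _ hT'
      rw [map_smul, hmono, map_smul, map_smul, b.repr_self, Finsupp.smul_apply, Finsupp.smul_apply,
        Finsupp.single_eq_of_ne (Ne.symm hT'), smul_zero, smul_zero]
    · intro h; exact absurd (Finset.mem_univ T) h
  have h2 : b.repr (complexBetti.map f d c) T = weightChar S a * b.repr c T := by
    rw [(mem_weightClassesAlg_iff.1 hc) a, map_smul, Finsupp.smul_apply, smul_eq_mul]
    rfl
  exact mul_right_cancel₀ hT (h1.symm.trans h2)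

end Weights

section WeightsConst

open scoped Classical

variable {n : ℕ} {K : Type} [Field K] [NumberField K]

/-- The index `(i, s) ∈ ⊔_{i<n} Hom(K, ℂ)` of the eigenline `π_i^* H¹(A_i)_s`. [cite: Milne2020HodgeClassesAV, 1.2 (a)] -/
abbrev slot (i : Fin n) (s : K →+* ℂ) : (_ : Fin n) × (K →+* ℂ) := ⟨i, s⟩

omit [NumberField K] in
/-- The weight character at the family `(1, …, 1, α, 1, …, 1)` (`α` in slot `k`): `∏_{(k,s) ∈ S} s(α)`. [folklore] -/
private theorem weightChar_update (S : Finset ((_ : Fin n) × (K →+* ℂ))) (k : Fin n) (α : 𝓞 K) :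
    weightChar (K := fun _ => K) S (Function.update (fun _ => (1 : 𝓞 K)) k α) =
      ∏ x ∈ S, (if x.1 = k then x.2 (α : K) else 1) := by
  unfold weightChar
  refine Finset.prod_congr rfl fun x _ => ?_
  change x.2 (((Function.update (fun _ => (1 : 𝓞 K)) k α) x.1 : 𝓞 K) : K) = _
  rw [Function.update_apply]
  split_ifs with h
  · rfl
  · rw [RingOfIntegers.coe_eq_algebraMap, map_one, map_one]

omit [NumberField K] in
/-- At `α = 2` the weight character is `2^{#(S ∩ slot k)}`: it counts the members of `S` in slot `k`. [folklore] -/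
private theorem weightChar_update_two (S : Finset ((_ : Fin n) × (K →+* ℂ))) (k : Fin n) :
    weightChar (K := fun _ => K) S (Function.update (fun _ => (1 : 𝓞 K)) k 2) =
      2 ^ (S.filter fun x => x.1 = k).card := by
  classical
  rw [weightChar_update]
  have h2 : ∀ x : (_ : Fin n) × (K →+* ℂ), x.2 ((2 : 𝓞 K) : K) = 2 := fun x => by
    rw [RingOfIntegers.coe_eq_algebraMap, map_ofNat, map_ofNat]
  simp_rw [h2]
  rw [Finset.prod_ite, Finset.prod_const, Finset.prod_const_one, mul_one]

omit [NumberField K] in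
/-- A pair with two different slots has exactly one member in each of them. [folklore] -/
private theorem card_filter_pair_fst {i j : Fin n} (hij : i ≠ j) (s t : K →+* ℂ) :
    (({slot i s, slot j t} : Finset ((_ : Fin n) × (K →+* ℂ))).filter fun x => x.1 = i).card = 1 ∧
    (({slot i s, slot j t} : Finset ((_ : Fin n) × (K →+* ℂ))).filter fun x => x.1 = j).card = 1 := by
  classical
  constructor
  · rw [Finset.filter_insert, if_pos rfl, Finset.filter_singleton, if_neg (Ne.symm hij), insert_empty_eq,
      Finset.card_singleton]
  · rw [Finset.filter_insert, if_neg hij, Finset.filter_singleton, if_pos rfl, Finset.card_singleton]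

/-- A `2`-set `S` with the weight character of a transversal pair `{(i,s), (j,t)}` (`i ≠ j`) IS that pair: the
slot counts agree (test at `α = 2` in each slot), so `S = {x, y}` with `x` in slot `i`, `y` in slot `j`, and then
`x.2 = s`, `y.2 = t` as ring maps `K → ℂ` agreeing on `𝓞_K` (test at `(1,…,α,…,1)`, `α ∈ 𝓞_K`; `K = Frac 𝓞_K`).
[folklore] -/
private theorem eq_pair_of_weightChar_eq {S : Finset ((_ : Fin n) × (K →+* ℂ))} (hS : S.card = 2)
    {i j : Fin n} (hij : i ≠ j) (s t : K →+* ℂ)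
    (h : ∀ a : Fin n → 𝓞 K, weightChar (K := fun _ => K) S a =
      weightChar (K := fun _ => K) ({slot i s, slot j t} : Finset ((_ : Fin n) × (K →+* ℂ))) a) :
    S = {slot i s, slot j t} := by
  classical
  -- (1) slot counts: exactly one member of `S` in slot `i`, one in slot `j`
  have hcount : ∀ k : Fin n, (S.filter fun x => x.1 = k).card =
      (({slot i s, slot j t} : Finset ((_ : Fin n) × (K →+* ℂ))).filter fun x => x.1 = k).card := by
    intro k
    have hk := h (Function.update (fun _ => (1 : 𝓞 K)) k 2)
    rw [weightChar_update_two, weightChar_update_two] at hk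
    have hk' : ((2 ^ (S.filter fun x => x.1 = k).card : ℕ) : ℂ) =
        ((2 ^ (({slot i s, slot j t} : Finset ((_ : Fin n) × (K →+* ℂ))).filter fun x => x.1 = k).card : ℕ) : ℂ) := by
      push_cast; exact hk
    exact Nat.pow_right_injective le_rfl (Nat.cast_injective hk')
  obtain ⟨hci, hcj⟩ := card_filter_pair_fst hij s t
  obtain ⟨x, hx⟩ := Finset.card_eq_one.1 ((hcount i).trans hci)
  obtain ⟨y, hy⟩ := Finset.card_eq_one.1 ((hcount j).trans hcj)
  have hxS : x ∈ S ∧ x.1 = i := by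
    have := Finset.mem_singleton_self x; rw [← hx, Finset.mem_filter] at this; exact this
  have hyS : y ∈ S ∧ y.1 = j := by
    have := Finset.mem_singleton_self y; rw [← hy, Finset.mem_filter] at this; exact this
  have hxy : x ≠ y := fun hxy => hij (by rw [← hxS.2, ← hyS.2, hxy])
  -- (2) `S = {x, y}`
  have hSxy : S = {x, y} := by
    symm
    apply Finset.eq_of_subset_of_card_le
    · intro z hz
      rcases Finset.mem_insert.1 hz with rfl | hz
      · exact hxS.1
      · rw [Finset.mem_singleton.1 hz]; exact hyS.1
    · rw [hS, Finset.card_pair hxy]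
  -- (3) the embeddings: test with `(1, …, α, …, 1)` in slot `i`, then in slot `j`
  have hyi : y.1 ≠ i := fun h' => hij (h'.symm.trans hyS.2 ▸ rfl)
  have hxj : x.1 ≠ j := fun h' => hij (hxS.2.symm.trans h')
  have hx2 : x.2 = s := by
    refine IsLocalization.ringHom_ext (nonZeroDivisors (𝓞 K)) (RingHom.ext fun α => ?_)
    have hα := h (Function.update (fun _ => (1 : 𝓞 K)) i α)
    rw [hSxy, weightChar_update, weightChar_update, Finset.prod_pair hxy,
      Finset.prod_pair (fun h => hij (congrArg Sigma.fst h)), if_pos hxS.2, if_neg hyi] at hα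
    simp only [if_true, if_neg (Ne.symm hij), mul_one] at hα
    exact hα
  have hy2 : y.2 = t := by
    refine IsLocalization.ringHom_ext (nonZeroDivisors (𝓞 K)) (RingHom.ext fun α => ?_)
    have hα := h (Function.update (fun _ => (1 : 𝓞 K)) j α)
    rw [hSxy, weightChar_update, weightChar_update, Finset.prod_pair hxy,
      Finset.prod_pair (fun h => hij (congrArg Sigma.fst h)), if_neg hxj, if_pos hyS.2] at hα
    simp only [if_true, if_neg hij, one_mul] at hα
    exact hα
  have hx : x = slot i s := Sigma.ext hxS.2 (heq_of_eq hx2)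
  have hy : y = slot j t := Sigma.ext hyS.2 (heq_of_eq hy2)
  rw [hSxy, hx, hy]

end WeightsConst


/-! ### Hazama's set `P₀` and its (non-)balanced subsets -/

section HazamaSet

open scoped Classical

variable {K : Type} [Field K]

/-- `P₀ = {(i, s₀) | i < 6}`: the same embedding in each of the six slots — the `6`-subset of `⊔_{i<6} Hom(K, ℂ)`
rendering Hazama's height-`3` vector `v` (one eigenline in each of the six factors). [cite: Hazama2003GHCCM, Remark 7.15 p. 650] -/
def hazamaSet (s₀ : K →+* ℂ) : Finset ((_ : Fin 6) × (K →+* ℂ)) :=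
  Finset.univ.image fun i => slot i s₀

/-- `i ↦ (i, s₀)` is injective. [folklore] -/
private theorem slot_injective (s₀ : K →+* ℂ) : Function.Injective fun i : Fin 6 => slot i s₀ :=
  fun _ _ h => congrArg Sigma.fst h

/-- `#P₀ = 6`. [cite: Hazama2003GHCCM, Remark 7.15 p. 650] -/
theorem card_hazamaSet (s₀ : K →+* ℂ) : (hazamaSet s₀).card = 6 := by
  rw [hazamaSet, Finset.card_image_of_injective _ (slot_injective s₀), Finset.card_univ, Fintype.card_fin]

/-- Counting the members of `J × {s₀}` with a property = counting the slots `i ∈ J` with it. [folklore] -/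
private theorem ncard_sep_image_slot (s₀ : K →+* ℂ) (J : Finset (Fin 6)) (Q : ((_ : Fin 6) × (K →+* ℂ)) → Prop) :
    {x | x ∈ J.image (fun i => slot i s₀) ∧ Q x}.ncard = (J.filter fun i => Q (slot i s₀)).card := by
  have hset : {x | x ∈ J.image (fun i => slot i s₀) ∧ Q x} =
      ↑((J.filter fun i => Q (slot i s₀)).image fun i => slot i s₀) := by
    ext x
    simp only [Set.mem_setOf_eq, Finset.coe_image, Finset.coe_filter, Set.mem_image, Finset.mem_image]
    constructor
    · rintro ⟨⟨i, hi, rfl⟩, hQ⟩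
      exact ⟨i, ⟨hi, hQ⟩, rfl⟩
    · rintro ⟨i, ⟨hi, hQ⟩, rfl⟩
      exact ⟨⟨i, hi, rfl⟩, hQ⟩
  rw [hset, Set.ncard_coe_finset, Finset.card_image_of_injective _ (slot_injective s₀)]

/-- The `2`-subsets of `P₀` are the pairs `{(i, s₀), (j, s₀)}`, `i ≠ j`. [folklore] -/
private theorem exists_pair_of_subset_hazamaSet {s₀ : K →+* ℂ} {T : Finset ((_ : Fin 6) × (K →+* ℂ))}
    (hT : T ⊆ hazamaSet s₀) (hT2 : T.card = 2) :
    ∃ i j : Fin 6, i ≠ j ∧ T = {slot i s₀, slot j s₀} := by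
  obtain ⟨x, y, hxy, rfl⟩ := Finset.card_eq_two.1 hT2
  have hx := hT (Finset.mem_insert_self x {y})
  have hy := hT (Finset.mem_insert_of_mem (Finset.mem_singleton_self y))
  rw [hazamaSet, Finset.mem_image] at hx hy
  obtain ⟨i, -, rfl⟩ := hx
  obtain ⟨j, -, rfl⟩ := hy
  exact ⟨i, j, fun h => hxy (by rw [h]), rfl⟩

variable [NumberField K] {Φ : CMType K} {e : Fin 4 → (K →+* ℂ)}

omit [NumberField K] in
/-- **`P₀` is Galois-balanced**: for every `τ ∈ Aut(ℂ)` the embedding `τ ∘ s₀` is some `e k` or some `conj (e k)`,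
and either lies in exactly three of the six types (each coordinate of `v` carries three `0`'s and three `1`'s,
Hazama's (5.3)). [cite: Hazama2003GHCCM, Remark 7.15 p. 650] [cite: GaoUllmo2025, Thm. 3.1 (3.2)] -/
theorem isGaloisBalancedAlg_hazamaSet (he : Function.Injective e) (hΦe : ∀ t, t ∈ Φ.1 ↔ t ∈ Set.range e) :
    IsGaloisBalancedAlg (K := fun _ => K) (hazamaFamily Φ e) (hazamaSet (e 0)) := by
  intro τ
  rw [hazamaSet, ncard_sep_image_slot, ncard_sep_image_slot]
  dsimp only [slot]
  by_cases ht : (τ : ℂ →+* ℂ).comp (e 0) ∈ Φ.1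
  · obtain ⟨k, hk⟩ := (hΦe _).1 ht
    simp_rw [← hk, mem_hazamaFamily_iff_of_eq he hΦe k]
    rw [(card_filter_mem_hazamaFamily k).1, (card_filter_mem_hazamaFamily k).2]
  · obtain ⟨k, hk⟩ := (hΦe _).1 (conjugate_mem_of_not_mem Φ ht)
    have hk' : (τ : ℂ →+* ℂ).comp (e 0) = conjugate (e k) := by
      rw [hk]; exact (involutive_conjugate K _).symm
    simp_rw [hk', conjugate_mem_hazamaFamily_iff he hΦe k]
    rw [(card_filter_conjugate_mem_hazamaFamily k).1, (card_filter_conjugate_mem_hazamaFamily k).2]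

omit [NumberField K] in
/-- `P₀ ∈ pohlmannSetsAlg _ 3` (a balanced `6`-set). [cite: Hazama2003GHCCM, Remark 7.15 p. 650] [cite: GaoUllmo2025, Thm. 3.1 (3.2)] -/
theorem hazamaSet_mem_pohlmannSetsAlg (he : Function.Injective e) (hΦe : ∀ t, t ∈ Φ.1 ↔ t ∈ Set.range e) :
    hazamaSet (e 0) ∈ pohlmannSetsAlg (K := fun _ => K) (hazamaFamily Φ e) 3 :=
  ⟨card_hazamaSet (e 0), isGaloisBalancedAlg_hazamaSet he hΦe⟩

/-- **No pair `{(i, s₀), (j, s₀)}`, `i ≠ j`, is Galois-balanced** (no two of the six sign vectors of `v` are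
complementary): move `s₀ = e 0` to the witness `e k` of `hazamaFamily_exists_witness` by an automorphism of `ℂ`
(`exists_ringEquiv_apply_eq`: `Aut(ℂ)` is transitive on `Hom(K, ℂ)`), which then lies in both types or in
neither, so the counts are `2, 0` or `0, 2`, not `1, 1`. [cite: Hazama2003GHCCM, Remark 7.15 p. 650] [cite: GaoUllmo2025, Thm. 3.1 (3.2)] -/
theorem not_isGaloisBalancedAlg_pair (he : Function.Injective e) (hΦe : ∀ t, t ∈ Φ.1 ↔ t ∈ Set.range e)
    {i j : Fin 6} (hij : i ≠ j) :
    ¬ IsGaloisBalancedAlg (K := fun _ => K) (hazamaFamily Φ e) {slot i (e 0), slot j (e 0)} := by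
  obtain ⟨k, hk⟩ := hazamaFamily_exists_witness i j hij
  -- an automorphism of `ℂ` moving `e 0` to `e k`
  have hΩ : Cardinal.aleph0 < Cardinal.mk ℂ := by
    rw [Cardinal.mk_complex]; exact Cardinal.aleph0_lt_continuum
  have hKc : Countable K := Function.Injective.countable (Module.finBasis ℚ K).equivFun.injective
  have hK : Cardinal.mk K ≤ Cardinal.aleph0 := Cardinal.mk_le_aleph0_iff.mpr hKc
  obtain ⟨σ, hσ⟩ := Literature.FieldTheory.AlgClosed.exists_ringEquiv_apply_eq hΩ hK (e 0) (e k)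
  have hσ' : (σ : ℂ →+* ℂ).comp (e 0) = e k := RingHom.ext hσ
  intro hbal
  have h := hbal σ
  have hpair : ({slot i (e 0), slot j (e 0)} : Finset ((_ : Fin 6) × (K →+* ℂ))) =
      ({i, j} : Finset (Fin 6)).image fun m => slot m (e 0) := by
    rw [Finset.image_insert, Finset.image_singleton]
  rw [hpair, ncard_sep_image_slot, ncard_sep_image_slot] at h
  dsimp only [slot] at h
  simp_rw [hσ', mem_hazamaFamily_iff_of_eq he hΦe k] at h
  by_cases hi : (i.val < 4 → k.val = i.val)
  · have hj : (j.val < 4 → k.val = j.val) := hk.1 hi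
    rw [Finset.filter_true_of_mem (fun m hm => by
        rcases Finset.mem_insert.1 hm with rfl | hm
        · exact hi
        · rw [Finset.mem_singleton.1 hm]; exact hj),
      Finset.filter_false_of_mem (fun m hm => by
        rcases Finset.mem_insert.1 hm with rfl | hm
        · exact not_not_intro hi
        · rw [Finset.mem_singleton.1 hm]; exact not_not_intro hj),
      Finset.card_pair hij, Finset.card_empty] at h
    exact absurd h (by decide)
  · have hj : ¬ (j.val < 4 → k.val = j.val) := fun hj => hi (hk.2 hj)
    rw [Finset.filter_false_of_mem (fun m hm => by
        rcases Finset.mem_insert.1 hm with rfl | hm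
        · exact hi
        · rw [Finset.mem_singleton.1 hm]; exact hj),
      Finset.filter_true_of_mem (fun m hm => by
        rcases Finset.mem_insert.1 hm with rfl | hm
        · exact hi
        · rw [Finset.mem_singleton.1 hm]; exact hj),
      Finset.card_pair hij, Finset.card_empty] at h
    exact absurd h (by decide)

end HazamaSet

/-! ### Divisor classes have no coordinate on the pairs of `P₀` -/

section DivisorCoordinates

open scoped Classical

variable {K : Type} [Field K] [NumberField K] {Φ : CMType K} {e : Fin 4 → (K →+* ℂ)}
  {A : Fin 6 → AbelianVariety ℂ} {ι : ∀ i : Fin 6, 𝓞 K →+* End (A i)}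
  {θ : ∀ i : Fin 6, K →+* Module.End ℂ (complexBetti (A i).X 1)}

/-- **A weight class of a balanced `2`-weight `S` has zero coordinate on every pair `T ⊆ P₀`**: otherwise
`χ_S = χ_T`, so `S = T` (`eq_pair_of_weightChar_eq`), but `T` is not balanced. [cite: Hazama2003GHCCM, Remark 7.15 p. 650] [cite: Pohlmann1968, Thm. 1] -/
theorem repr_weightClass_pair_eq_zero [LinearOrder ((_ : Fin 6) × (K →+* ℂ))]
    (he : Function.Injective e) (hΦe : ∀ t, t ∈ Φ.1 ↔ t ∈ Set.range e)
    {w : Module.Basis ((_ : Fin 6) × (K →+* ℂ)) ℂ (complexBetti (⨁ A).X 1)}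
    (hw : ∀ (c : Fin 6 → 𝓞 K) (x : (_ : Fin 6) × (K →+* ℂ)),
      complexBetti.map (biproduct.map fun i => ι i (c i)).hom.hom.hom 1 (w x) = x.2 (c x.1 : K) • w x)
    {b : Module.Basis (Set.powersetCard ((_ : Fin 6) × (K →+* ℂ)) (2 * 1)) ℂ (complexBetti (⨁ A).X (2 * 1))}
    (hb : ∀ s, b s = cupPowOne ℂ (ComplexPoints (⨁ A).X) (2 * 1)
      (fun j => w (Set.powersetCard.ofFinEmbEquiv.symm s j)))
    {S : Finset ((_ : Fin 6) × (K →+* ℂ))} (hS : S ∈ pohlmannSetsAlg (K := fun _ => K) (hazamaFamily Φ e) 1)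
    {c : complexBetti (⨁ A).X (2 * 1)} (hc : c ∈ weightClassesAlg A ι (2 * 1) S)
    {T : Set.powersetCard ((_ : Fin 6) × (K →+* ℂ)) (2 * 1)} (hT : (T : Finset _) ⊆ hazamaSet (e 0)) :
    b.repr c T = 0 := by
  by_contra hne
  obtain ⟨i, j, hij, hTij⟩ := exists_pair_of_subset_hazamaSet hT (Set.powersetCard.card_eq T)
  have hχ : ∀ a : Fin 6 → 𝓞 K, weightChar (K := fun _ => K) S a =
      weightChar (K := fun _ => K) ({slot i (e 0), slot j (e 0)} : Finset ((_ : Fin 6) × (K →+* ℂ))) a :=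
    fun a => by rw [← hTij]; exact (weightChar_eq_of_repr_ne_zero hw hb hc hne a).symm
  have hS2 : S.card = 2 := hS.1
  have hST := eq_pair_of_weightChar_eq hS2 hij (e 0) (e 0) hχ
  exact not_isGaloisBalancedAlg_pair he hΦe hij (hST ▸ hS.2)

/-- **Every class of `B¹(⨁ A_i) ⊗ ℂ` has zero coordinate on every pair of `P₀`** (Pohlmann's theorem for
the CM algebra `K⁶`, `p = 1`: `B¹ ⊗ ℂ = ⊕_{S balanced pair} H²_S`, and the previous lemma).
[cite: Pohlmann1968, Thm. 1] [cite: Hazama2003GHCCM, (4.C)/(4.1) p. 631 and Remark 7.15 p. 650] -/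
theorem repr_eq_zero_of_mem_hodgeClassSpan_one [LinearOrder ((_ : Fin 6) × (K →+* ℂ))]
    (he : Function.Injective e) (hΦe : ∀ t, t ∈ Φ.1 ↔ t ∈ Set.range e)
    (hA : ∀ i, IsCMTypeRealisation (hazamaFamily Φ e i) (A i) (ι i) (θ i))
    {w : Module.Basis ((_ : Fin 6) × (K →+* ℂ)) ℂ (complexBetti (⨁ A).X 1)}
    (hw : ∀ (c : Fin 6 → 𝓞 K) (x : (_ : Fin 6) × (K →+* ℂ)),
      complexBetti.map (biproduct.map fun i => ι i (c i)).hom.hom.hom 1 (w x) = x.2 (c x.1 : K) • w x)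
    {b : Module.Basis (Set.powersetCard ((_ : Fin 6) × (K →+* ℂ)) (2 * 1)) ℂ (complexBetti (⨁ A).X (2 * 1))}
    (hb : ∀ s, b s = cupPowOne ℂ (ComplexPoints (⨁ A).X) (2 * 1)
      (fun j => w (Set.powersetCard.ofFinEmbEquiv.symm s j)))
    {x : complexBetti (⨁ A).X (2 * 1)} (hx : x ∈ hodgeClassSpan (⨁ A).dim (⨁ A).X 1)
    {T : Set.powersetCard ((_ : Fin 6) × (K →+* ℂ)) (2 * 1)} (hT : (T : Finset _) ⊆ hazamaSet (e 0)) :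
    b.repr x T = 0 := by
  rw [(Pohlmann1968_thm1_cmAlgebra (fun _ => K) A (hazamaFamily Φ e) ι θ hA 1).1] at hx
  have key : (⨆ S ∈ pohlmannSetsAlg (K := fun _ => K) (hazamaFamily Φ e) 1, weightClassesAlg A ι (2 * 1) S) ≤
      LinearMap.ker (b.coord T) :=
    iSup₂_le fun S hS c hc => by
      rw [LinearMap.mem_ker, Module.Basis.coord_apply]
      exact repr_weightClass_pair_eq_zero he hΦe hw hb hS hc hT
  have h := key hx
  rwa [LinearMap.mem_ker, Module.Basis.coord_apply] at h

end DivisorCoordinates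

/-! ### The ideal generated by divisor classes and the main theorem -/

section Main

variable (N : ℕ) (X : Literature.AlgebraicGeometry.Motives.SchemeOver ℂ)

/-- The degree-`6` part `(B¹ ⊗ ℂ) ⌣ H⁴ + H⁴ ⌣ (B¹ ⊗ ℂ)` of the two-sided ideal of `H^{2*}(X(ℂ); ℂ)` generated by
the complexified divisor classes `B¹(X) ⊗ ℂ` (rational `(1,1)`-classes); it contains van Geemen's `D³ ⊗ ℂ` and the
degree-`6` part of the subalgebra generated by `(B¹ ⊕ B²) ⊗ ℂ`. [cite: vanGeemen1994HodgeAV, §2.4]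
[cite: Milne2007TateFiniteFieldsAIM, §8 Thm. 8.3] -/
def divisorIdealSix : Submodule ℂ (complexBetti X (2 * 3)) :=
  Submodule.span ℂ
    ({y | ∃ x ∈ hodgeClassSpan N X 1, ∃ z : complexBetti X (2 * 2), y = cupProduct (rfl : 2 * 1 + 2 * 2 = 2 * 3) x z} ∪
     {y | ∃ x ∈ hodgeClassSpan N X 1, ∃ z : complexBetti X (2 * 2), y = cupProduct (rfl : 2 * 2 + 2 * 1 = 2 * 3) z x})

/-- The degree-`6` component `B¹B¹B¹ + B¹B² + B²B¹` (complexified, in every bracketing) of the subalgebra of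
`H^{2*}(X(ℂ); ℂ)` generated by the complexified Hodge classes of codimension `≤ 2`, `(B¹ ⊕ B²) ⊗ ℂ`: the span
of the cup products `(a ⌣ b) ⌣ c`, `a ⌣ (b ⌣ c)`, `a ⌣ z`, `z ⌣ a` with `a, b, c ∈ B¹ ⊗ ℂ`, `z ∈ B² ⊗ ℂ`
("the `ℚ`-algebra `B*` … generated by the classes of degree `≤ 2`", read in degree `3`; over `ℂ` it
contains `(ℚ`-subalgebra generated by `B¹ ⊕ B²)³ ⊗ ℂ`). [cite: Milne2007TateFiniteFieldsAIM, §8 Thm. 8.3]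
[cite: Hazama2003GHCCM, (4.3) p. 634] -/
def codimTwoGeneratedSix : Submodule ℂ (complexBetti X (2 * 3)) :=
  Submodule.span ℂ
    ((({y | ∃ a ∈ hodgeClassSpan N X 1, ∃ b ∈ hodgeClassSpan N X 1, ∃ c ∈ hodgeClassSpan N X 1,
          y = cupProduct (rfl : 2 * 2 + 2 * 1 = 2 * 3) (cupProduct (rfl : 2 * 1 + 2 * 1 = 2 * 2) a b) c} ∪
        {y | ∃ a ∈ hodgeClassSpan N X 1, ∃ b ∈ hodgeClassSpan N X 1, ∃ c ∈ hodgeClassSpan N X 1,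
          y = cupProduct (rfl : 2 * 1 + 2 * 2 = 2 * 3) a (cupProduct (rfl : 2 * 1 + 2 * 1 = 2 * 2) b c)}) ∪
      {y | ∃ a ∈ hodgeClassSpan N X 1, ∃ z ∈ hodgeClassSpan N X 2,
        y = cupProduct (rfl : 2 * 1 + 2 * 2 = 2 * 3) a z}) ∪
    {y | ∃ a ∈ hodgeClassSpan N X 1, ∃ z ∈ hodgeClassSpan N X 2,
      y = cupProduct (rfl : 2 * 2 + 2 * 1 = 2 * 3) z a})

variable {N X}

/-- Every degree-`6` product of classes of codimension `≤ 2` has a factor in `B¹ ⊗ ℂ` (`3 = 1+1+1 = 1+2 = 2+1`),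
so it lies in the degree-`6` part of the two-sided ideal generated by `B¹ ⊗ ℂ` (the notion "generated by the classes
of degree `≤ 2`" read in degree `3`). [cite: Milne2007TateFiniteFieldsAIM, §8 Thm. 8.3] [cite: vanGeemen1994HodgeAV, §2.4] -/
theorem codimTwoGeneratedSix_le_divisorIdealSix : codimTwoGeneratedSix N X ≤ divisorIdealSix N X := by
  refine Submodule.span_le.2 ?_
  rintro y (((⟨a, ha, b, -, c, hc, rfl⟩ | ⟨a, ha, b, -, c, -, rfl⟩) | ⟨a, ha, z, -, rfl⟩) | ⟨a, ha, z, -, rfl⟩)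
  · exact Submodule.subset_span (Or.inr ⟨c, hc, _, rfl⟩)
  · exact Submodule.subset_span (Or.inl ⟨a, ha, _, rfl⟩)
  · exact Submodule.subset_span (Or.inl ⟨a, ha, z, rfl⟩)
  · exact Submodule.subset_span (Or.inr ⟨a, ha, z, rfl⟩)

/-- van Geemen's `D³ ⊗ ℂ` (span of triple products of divisor classes, `divisorClassesSpan X N 3`) lies in the
degree-`6` part of the ideal generated by `B¹ ⊗ ℂ`. [cite: vanGeemen1994HodgeAV, §2.4] -/
theorem divisorClassesSpan_three_le_divisorIdealSix : divisorClassesSpan X N 3 ≤ divisorIdealSix N X := by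
  refine Submodule.span_le.2 fun y hy => ?_
  obtain ⟨a, -, b, hb, hb', rfl⟩ := (mem_divisorMonomials_succ (m := 2)).1 hy
  exact Submodule.subset_span (Or.inr ⟨b, Submodule.subset_span ⟨hb, hb'⟩, a, rfl⟩)

open scoped Classical

variable {K : Type} [Field K] [NumberField K]

/-- **MAIN THEOREM (Hazama 2003, Remark 7.15, through Pohlmann's monomial basis).** Let `K` be a number field
with a CM type `Φ = {e 0, e 1, e 2, e 3}` of four elements (`[K:ℚ] = 8`), and let `A_0, …, A_5` be abelian
varieties with `𝓞_K`-multiplication realising the six CM types `u_{e 0}, u_{e 1}, u_{e 2}, u_{e 3}, Φ, Φ`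
(`hazamaFamily`; `u_φ = {φ} ∪ conj(Φ ∖ {φ})`). Then the product `B = ⨁_i A_i` carries a RATIONAL Hodge class of
type `(3,3)` outside `(B¹(B) ⊗ ℂ) ⌣ H⁴ + H⁴ ⌣ (B¹(B) ⊗ ℂ)`, the degree-`6` part of the two-sided ideal of
`H^{2*}(B(ℂ); ℂ)` generated by the divisor classes. Proof: in the cup-monomial basis `[P]` (`P ⊆ ⊔_{i<6} Hom(K, ℂ)`)
on an `∏ 𝓞_K`-eigenbasis of `H¹(B)`, `B¹ ⊗ ℂ` is spanned by the balanced pairs (Pohlmann's theorem for the CM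
algebra `K⁶`, tree theorem `Pohlmann1968_thm1_cmAlgebra`), a product `[S] ⌣ [T]` is `± [S ∪ T]` or `0`, the
`6`-set `P₀ = {(i, e 0) | i < 6}` is balanced (every embedding of `K` lies in exactly three of the six types) and
contains NO balanced pair; so the `P₀`-coordinate vanishes on the ideal while `[P₀] ∈ B³ ⊗ ℂ`, and `B³ ⊗ ℂ` is
spanned by rational `(3,3)`-classes. In Hazama's coordinates relative to a frame `(φ₁, …, φ₄)` with
`Φ = (1,1,1,0)` the six types are `(1,0,0,1), (0,1,0,1), (0,0,1,1), (0,0,0,0), (1,1,1,0), (1,1,1,0)`: the vector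
`v = (0000) + (0011) + (0101) + (1001) + 2(1110)` of Remark 7.15.
[cite: Hazama2003GHCCM, Remark 7.15 p. 650, (4.C)/(4.1) p. 631, (5.3) p. 636] [cite: Pohlmann1968, Thm. 1] -/
theorem exists_hodgeClass_not_mem_divisorIdealSix (Φ : CMType K) (e : Fin 4 → (K →+* ℂ))
    (he : Function.Injective e) (hΦe : ∀ t, t ∈ Φ.1 ↔ t ∈ Set.range e)
    (A : Fin 6 → AbelianVariety ℂ) (ι : ∀ i : Fin 6, 𝓞 K →+* End (A i))
    (θ : ∀ i : Fin 6, K →+* Module.End ℂ (complexBetti (A i).X 1))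
    (hA : ∀ i, IsCMTypeRealisation (hazamaFamily Φ e i) (A i) (ι i) (θ i)) :
    ∃ c : complexBetti (⨁ A).X (2 * 3), IsRationalClass c ∧ IsOfHodgeType (⨁ A).dim (⨁ A).X (2 * 3) 3 3 c ∧
      c ∉ divisorIdealSix (⨁ A).dim (⨁ A).X := by
  -- (1) the eigenbasis of `H¹` and the monomial bases of `H²`, `H⁴`, `H⁶`
  obtain ⟨w, hw, -, -⟩ := exists_eigenbasis_biproduct (K := fun _ => K) hA
  letI : LinearOrder ((_ : Fin 6) × (K →+* ℂ)) :=
    LinearOrder.lift' (Fintype.equivFin ((_ : Fin 6) × (K →+* ℂ)))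
      (Fintype.equivFin ((_ : Fin 6) × (K →+* ℂ))).injective
  obtain ⟨b₂, hb₂⟩ := exists_monomialBasis w (2 * 1)
  obtain ⟨b₄, hb₄⟩ := exists_monomialBasis w (2 * 2)
  obtain ⟨b₆, hb₆⟩ := exists_monomialBasis w (2 * 3)
  -- (2) the monomial `[P₀]` is a Hodge class
  let P₀ : Set.powersetCard ((_ : Fin 6) × (K →+* ℂ)) (2 * 3) := ⟨hazamaSet (e 0), card_hazamaSet (e 0)⟩
  have hP₀ : hazamaSet (e 0) ∈ pohlmannSetsAlg (K := fun _ => K) (hazamaFamily Φ e) 3 :=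
    hazamaSet_mem_pohlmannSetsAlg he hΦe
  have hmono : b₆ P₀ ∈ hodgeClassSpan (⨁ A).dim (⨁ A).X 3 := by
    refine weightClassesAlg_le_hodgeClassSpan hA hP₀ ((mem_weightClassesAlg_iff).2 fun a => ?_)
    exact map_monomial_eq_prod_smul hb₆ _ (hw a) P₀
  -- (3) the ideal has zero `P₀`-coordinate
  have hideal : divisorIdealSix (⨁ A).dim (⨁ A).X ≤ LinearMap.ker (b₆.coord P₀) := by
    refine Submodule.span_le.2 ?_
    rintro y (⟨x, hx, z, rfl⟩ | ⟨x, hx, z, rfl⟩)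
    · exact coord_cupProduct_eq_zero_left w rfl hb₂ hb₄ hb₆ P₀
        (fun T hT => repr_eq_zero_of_mem_hodgeClassSpan_one he hΦe hA hw hb₂ hx hT) z
    · exact coord_cupProduct_eq_zero_right w rfl hb₄ hb₂ hb₆ P₀ z
        (fun T hT => repr_eq_zero_of_mem_hodgeClassSpan_one he hΦe hA hw hb₂ hx hT)
  have hnot : b₆ P₀ ∉ divisorIdealSix (⨁ A).dim (⨁ A).X := fun h => by
    have h1 := hideal h
    rw [LinearMap.mem_ker, Module.Basis.coord_apply, b₆.repr_self, Finsupp.single_eq_same] at h1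
    exact one_ne_zero h1
  -- (4) some RATIONAL `(3,3)`-class is outside the ideal
  by_contra hall
  push Not at hall
  have hle : hodgeClassSpan (⨁ A).dim (⨁ A).X 3 ≤ divisorIdealSix (⨁ A).dim (⨁ A).X :=
    Submodule.span_le.2 fun c hc => hall c hc.1 hc.2
  exact hnot (hle hmono)

/-- **The Hodge ring of `B = ∏_{i<6} A_i` is not generated in codimension `≤ 2`**: a rational `(3,3)`-class of
`B` outside `B¹B¹B¹ + B¹B² + B²B¹` (complexified, all bracketings) — so "the `ℚ`-algebra `B*(Aⁿ)` is generated
by the classes of degree `≤ 2`" [Milne, Thm. 8.3, citing Hazama §7] fails for this isogeny factor of a power of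
`A_{A(2⁴)}(G;K)` (`K` Galois of degree `8`), whereas Hazama's `2`-dominatedness (Thm. 7.14, Remark 7.15:
`v = z₂₄ + z₃₄ − z₂₃ + d₀₁₁₀`, a `ℚ`-combination transported by correspondences, [3] Prop. 4.9) is not this
statement. [cite: Hazama2003GHCCM, Remark 7.15 and Thm. 7.14 p. 650] [cite: Milne2007TateFiniteFieldsAIM, §8 Thm. 8.3]

BARRIER (D-0021)
* technique_class: hodge-ring-generated-in-low-codimension, cup-product, multiplicativity-of-algebraic-classes, reduction-to-codimension-two-by-products — arguments deducing the algebraicity of ALL Hodge classes on (powers / products of) CM abelian varieties from the algebraicity of the classes of codimension `≤ 2` using only that the algebraic classes form a subring (products and sums of algebraic classes are algebraic); formally: the inclusion `B³ ⊗ ℂ ⊆ codimTwoGeneratedSix` (all of `B³` in the span of cup products of classes from `B¹ ⊗ ℂ`, `B² ⊗ ℂ`)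
* blocks: the statement "for every `n ≥ 0`, the `ℚ`-algebra `B*(Aⁿ)` is generated by the classes of degree `≤ 2`" [cite: Milne2007TateFiniteFieldsAIM, §8 Thm. 8.3] for `m = 4` (`K` a Galois CM field of degree `8`, `A = A(G,K,ρ_Φ)`: the product `∏_{i<6} A_i` below is, up to isogeny, an abelian subvariety of a power of `A` by [cite: Milne2007TateFiniteFieldsAIM, §8 Prop. 8.4] = [cite: Hazama2003GHCCM, Prop. 6.5 p. 644], and generation in degree `≤ 2` passes to isogeny factors, restriction of Hodge classes to a direct factor being surjective, cf. [cite: Hazama2003GHCCM, Lemma 2.1 p. 627]), hence the one-line mechanism of [cite: Milne2007TateFiniteFieldsAIM, §8 proof of Thm. 8.5] ("Theorem 8.3 shows that it holds for the varieties `A(G,K,ρ_Φ)ⁿ`") read as closure of algebraic classes under products; any route to `HC_CM` (`Summit.HodgeConjecture…CMAbelianHodge`) of the shape "HC in codimension `2` + products"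
* because: in the monomial basis `[P]` of `H^{2*}(∏ A_i; ℂ)` on an `∏ 𝓞_K`-eigenbasis of `H¹`, `Bᵖ ⊗ ℂ` is spanned by the balanced `2p`-sets [cite: Pohlmann1968, Thm. 1] [cite: Hazama2003GHCCM, (4.C)/(4.1) p. 631, (5.3) p. 636], products of monomials are `±` monomials of unions, and Hazama's six sign vectors `(0000), (0011), (0101), (1001), (1110), (1110)` are balanced with no complementary (= balanced) sub-pair [cite: Hazama2003GHCCM, Remark 7.15 p. 650]; so `[P₀] ∈ B³ ⊗ ℂ` has zero coordinate along the whole ideal generated by `B¹ ⊗ ℂ`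
* evasions_known: Hazama's own mechanism — `2`-dominatedness [cite: Hazama2003GHCCM, Thm. 7.13–7.14 p. 650]: the kernel of the Hodge matrix is spanned OVER `ℚ` by height-`≤ 2` vectors (`v = z₂₄ + z₃₄ − z₂₃ + d₀₁₁₀`), and the algebraicity of `[P_v]` follows from that of codimension-`2` cycles on OTHER powers through correspondences / cutting by divisors and hard Lefschetz [cite: Hazama2003GHCCM, Prop. 4.2–4.3 pp. 632–634, Remark 7.15 p. 650] (and [3] Prop. 4.9, not held); this gives Hazama's Thm. 8.3 p. 655 = Milne's Thm. 8.5 (HC for CM abelian varieties ⇐ HC in codimension `2` on the `A_{A(2ⁿ)}(G;K)`), which this barrier does NOT touch; routes through correspondences, motivated cycles (André) or Weil classes are likewise outside the technique class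
* scope_caveats: formal content = for ANY number field `K` with a `4`-element CM type `Φ` (so `[K:ℚ] = 8`, `K` Galois or not) and ANY realisations `A_0, …, A_5` of the six types `u_φ (φ ∈ Φ), Φ, Φ`, a rational `(3,3)`-class on `⨁ A_i` outside `codimTwoGeneratedSix` (and outside `divisorIdealSix`, `D³ ⊗ ℂ`); NOT formalised: Hazama's / Milne's variety `A_{A(2⁴)}(G;K) = A(G,K,ρ)` itself, the isogeny embedding `∏ A_i ↪ Aᴺ` (Prop. 6.5 / 8.4) and the passage of "generated in degree `≤ 2`" to isogeny factors — the refutation of Thm. 8.3 AS PRINTED is this file's theorem plus that prose step; Hazama's wording (4.3) "spanned by the Hodge classes `[P]` with `#P ≤ 2N`" is ambiguous between the two readings and his [3] Def. 4.5 was not consulted (not held); nothing here bears on representations `ρ ≠ ρ_Φ` separately, on `m ≠ 4`, or on simple CM abelian varieties (the product `∏ A_i` is not simple)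
* status: established -/
theorem exists_hodgeClass_not_mem_codimTwoGeneratedSix (Φ : CMType K) (e : Fin 4 → (K →+* ℂ))
    (he : Function.Injective e) (hΦe : ∀ t, t ∈ Φ.1 ↔ t ∈ Set.range e)
    (A : Fin 6 → AbelianVariety ℂ) (ι : ∀ i : Fin 6, 𝓞 K →+* End (A i))
    (θ : ∀ i : Fin 6, K →+* Module.End ℂ (complexBetti (A i).X 1))
    (hA : ∀ i, IsCMTypeRealisation (hazamaFamily Φ e i) (A i) (ι i) (θ i)) :
    ∃ c : complexBetti (⨁ A).X (2 * 3), IsRationalClass c ∧ IsOfHodgeType (⨁ A).dim (⨁ A).X (2 * 3) 3 3 c ∧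
      c ∉ codimTwoGeneratedSix (⨁ A).dim (⨁ A).X := by
  obtain ⟨c, hcQ, hcH, hc⟩ := exists_hodgeClass_not_mem_divisorIdealSix Φ e he hΦe A ι θ hA
  exact ⟨c, hcQ, hcH, fun h => hc (codimTwoGeneratedSix_le_divisorIdealSix h)⟩

/-- **An exceptional Hodge class of codimension `3`** on `B = ∏_{i<6} A_i` in van Geemen's sense: a rational
`(3,3)`-class outside `D³ ⊗ ℂ = span_ℂ (divisorMonomials B 3)` (the formal content of the catalogue's
`Weil1977_exceptionalHodgeClasses` on this particular CM abelian variety of dimension `24`).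
[cite: Hazama2003GHCCM, Remark 7.15 p. 650] [cite: vanGeemen1994HodgeAV, §2.5] -/
theorem exists_hodgeClass_not_mem_divisorClassesSpan_three (Φ : CMType K) (e : Fin 4 → (K →+* ℂ))
    (he : Function.Injective e) (hΦe : ∀ t, t ∈ Φ.1 ↔ t ∈ Set.range e)
    (A : Fin 6 → AbelianVariety ℂ) (ι : ∀ i : Fin 6, 𝓞 K →+* End (A i))
    (θ : ∀ i : Fin 6, K →+* Module.End ℂ (complexBetti (A i).X 1))
    (hA : ∀ i, IsCMTypeRealisation (hazamaFamily Φ e i) (A i) (ι i) (θ i)) :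
    ∃ c : complexBetti (⨁ A).X (2 * 3), IsRationalClass c ∧ IsOfHodgeType (⨁ A).dim (⨁ A).X (2 * 3) 3 3 c ∧
      c ∉ divisorClassesSpan (⨁ A).X (⨁ A).dim 3 := by
  obtain ⟨c, hcQ, hcH, hc⟩ := exists_hodgeClass_not_mem_divisorIdealSix Φ e he hΦe A ι θ hA
  exact ⟨c, hcQ, hcH, fun h => hc (divisorClassesSpan_three_le_divisorIdealSix h)⟩

end Main

/-! ### Closed form: every CM field of degree `8`, given the realisations of its CM types -/

section AnyCMField

open scoped Classical

open Literature.NumberTheory.Automorphic (PicardCM.CMAbelianVarietyRealised)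

/-- **For every CM field `K` of degree `8` and every CM type `Φ` of `K`** — granted the existence of abelian
varieties of prescribed CM type with `𝓞_K` acting (the tree's record `PicardCM.CMAbelianVarietyRealised`,
Shimura §6.2 Thm. 3, discharged Summits-side) — there are six `𝓞_K`-CM abelian varieties `A_0, …, A_5` of
types `u_φ (φ ∈ Φ), Φ, Φ` whose product carries a rational `(3,3)`-class outside the ideal generated by
`B¹ ⊗ ℂ` in degree `6`, hence outside the part of the Hodge ring generated in codimension `≤ 2` and outside
`D³ ⊗ ℂ`. [cite: Hazama2003GHCCM, Remark 7.15 p. 650] [cite: Shimura1998, §6.2 Theorem 3] -/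
theorem exists_cmProduct_hodgeRing_not_generated_in_codim_two (h₃ : PicardCM.CMAbelianVarietyRealised)
    (K : Type) [Field K] [NumberField K] [IsCMField K] (hK : Module.finrank ℚ K = 8) (Φ : CMType K) :
    ∃ (e : Fin 4 → (K →+* ℂ)) (A : Fin 6 → AbelianVariety ℂ) (ι : ∀ i : Fin 6, 𝓞 K →+* End (A i))
      (θ : ∀ i : Fin 6, K →+* Module.End ℂ (complexBetti (A i).X 1)),
      Function.Injective e ∧ (∀ t, t ∈ Φ.1 ↔ t ∈ Set.range e) ∧
      (∀ i, IsCMTypeRealisation (hazamaFamily Φ e i) (A i) (ι i) (θ i)) ∧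
      ∃ c : complexBetti (⨁ A).X (2 * 3), IsRationalClass c ∧ IsOfHodgeType (⨁ A).dim (⨁ A).X (2 * 3) 3 3 c ∧
        c ∉ divisorIdealSix (⨁ A).dim (⨁ A).X ∧ c ∉ codimTwoGeneratedSix (⨁ A).dim (⨁ A).X ∧
        c ∉ divisorClassesSpan (⨁ A).X (⨁ A).dim 3 := by
  -- an enumeration `e` of `Φ` (`2 · #Φ = [K:ℚ] = 8`)
  have h2 := Literature.NumberTheory.ComplexMultiplication.CMTypeLattice.two_mul_card_eq_finrank Φ
  rw [hK, Fintype.card_eq_nat_card] at h2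
  have h4 : Nat.card Φ.1 = 4 := by omega
  let ε : Φ.1 ≃ Fin 4 := (Finite.equivFin Φ.1).trans (finCongr h4)
  let e : Fin 4 → (K →+* ℂ) := fun k => (ε.symm k).1
  have he : Function.Injective e := Subtype.val_injective.comp ε.symm.injective
  have hΦe : ∀ t, t ∈ Φ.1 ↔ t ∈ Set.range e := fun t =>
    ⟨fun ht => ⟨ε ⟨t, ht⟩, by simp [e]⟩, by rintro ⟨k, rfl⟩; exact (ε.symm k).2⟩
  -- realisations of the six types
  have hR : ∀ i : Fin 6, ∃ (A : AbelianVariety ℂ) (ι : 𝓞 K →+* End A)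
      (θ : K →+* Module.End ℂ (complexBetti A.X 1)), IsCMTypeRealisation (hazamaFamily Φ e i) A ι θ :=
    fun i => h₃ K (hazamaFamily Φ e i)
  choose A ι θ hA using hR
  obtain ⟨c, hcQ, hcH, hc⟩ := exists_hodgeClass_not_mem_divisorIdealSix Φ e he hΦe A ι θ hA
  exact ⟨e, A, ι, θ, he, hΦe, hA, c, hcQ, hcH, hc, fun h => hc (codimTwoGeneratedSix_le_divisorIdealSix h),
    fun h => hc (divisorClassesSpan_three_le_divisorIdealSix h)⟩

end AnyCMField

end Literature.Barriers.HodgeConjecture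

end
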